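import Summits.HodgeConjecture.HodgeConjecture.Theorems.BoundaryReadoutPullbackAlgebraicZbarBookkeeping
import Summits.HodgeConjecture.HodgeConjecture.Theorems.BoundaryReadoutPullbackAlgebraicExceptionalDivisorLocallyTrivial
import Summits.HodgeConjecture.HodgeConjecture.Theorems.BoundaryReadoutPullbackAlgebraicExceptionalDivisorSmoothProjective
import Summits.HodgeConjecture.HodgeConjecture.Theorems.BoundaryReadoutPullbackAlgebraicSectionPullback
import Literature.AlgebraicGeometry.HodgeTheory.AlgebraicClassesPullback
import HarnessLib

/-!
# Crux `PullbackAlgebraic` (stmt-HodgeConjecture-1071) — PROVED: pull-back along any `ℂ`-morphism of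
# smooth projective complex varieties preserves algebraic classes `Nᵖ H²ᵖ`

Route `BoundaryReadout` (this file's route decl) and route `QbarEnvelope` (the shared item's primary decl)
of `HodgeConjecture`; line `normal_cone` of crux `PullbackAlgebraic` (stmt-HodgeConjecture-1071):
Fulton 1998, Cor. 19.2 (b) / Voisin II Prop. 9.21 (i) on the tree's support carrier
`algebraicClasses X p = Nᵖ H²ᵖ(X(ℂ); ℂ)`. The skeleton `Cruxes/PullbackAlgebraic/Lines/normal_cone.lean`
(reshape 2, constant lift) is assembled here WITHOUT `sorry` from landed theorems only:

* the constant-lift deformation to the normal cone with its constructed datum and closure bookkeeping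
  (`PullbackAlgebraic_of_exceptionalDivisor₂`, `Theorems/…ConstantLift`, `…DeformationDatum`,
  `…ZbarBookkeeping`: `T = ℙ¹`, `M = Bl_{X × {t₁}}(Y ⊗ T)`, `φ^* c = w + k_* u` by Deligne + Hironaka,
  the `t₀`-slice misses the exceptional divisor, slice homotopy);
* the Zariski-local triviality of exceptional divisors (`stub_exceptionalDivisorLocallyTrivial`, i.e. the
  discharged named fact `Resolution.Hartshorne1977_exceptionalDivisor_locallyTrivial_holds`,
  Hartshorne II 8.24 (b)) and their smooth projectivity (`stub_exceptionalDivisorSmoothProjective`);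
* the section pull-back for Zariski-locally trivial `ℙʳ`-bundles (`sectionPullback`, from the landed
  `stub_cupDivisor`, `stub_bundlePullback`, `stub_bundleLerayHirsch`, `stub_lerayHirschReadout`:
  Leray–Hirsch expansion + top-down Gysin extraction with divisor cups only).

* `fulton1998_map_mem_algebraicClasses_holds` — the tree's NAMED FACT
  `HodgeTheory.fulton1998_map_mem_algebraicClasses` (Fulton Cor. 19.2 (b), file
  `HodgeTheory/AlgebraicClassesPullback`), now a THEOREM (binder order: morphism, target, source);
* `pullbackAlgebraic_qbarEnvelope_proof` — `QbarEnvelope.PullbackAlgebraic` (primary decl of the item);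
* `boundaryReadout_pullbackAlgebraic_proof` — `BoundaryReadout.PullbackAlgebraic` (this route's decl).

## References

* [Fulton1998] W. Fulton, Intersection Theory, 2nd ed. (1998), §5.1, §6.2, Thm. 3.3 (b), Cor. 19.2 (b).
* [VoisinHodgeII2003] C. Voisin, Hodge Theory and Complex Algebraic Geometry II (2003), Prop. 9.21 (i).
* [Hartshorne1977] R. Hartshorne, Algebraic Geometry (1977), II Thm. 8.24 (b).
* [DeligneHodgeIII1974] P. Deligne, Théorie de Hodge III, Cor. 8.2.8.
-/

noncomputable section

-- `Summit.HodgeConjecture.HodgeConjecture.…` is the mandated namespace (single-conjunct summit).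
set_option linter.dupNamespace false

namespace Summit.HodgeConjecture.HodgeConjecture.Theorems

open CategoryTheory Literature.AlgebraicGeometry.HodgeTheory
open Summit.HodgeConjecture.HodgeConjecture.Theorems.PullbackAlgebraicNormalCone

/-- **Fulton's Cor. 19.2 (b) on the coniveau carrier, the tree's named fact
`fulton1998_map_mem_algebraicClasses`, PROVED**: for every `ℂ`-morphism `j : X ⟶ Y` of smooth
projective complex varieties and every `p`, `j^*(Nᵖ H²ᵖ(Y(ℂ); ℂ)) ⊆ Nᵖ H²ᵖ(X(ℂ); ℂ)`
(deformation to the normal cone in coniveau form, constant lift, Zariski-local triviality of the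
exceptional divisor, section pull-back by Leray–Hirsch; all consequences recorded in
`HodgeTheory/AlgebraicClassesPullback` under `(h : fulton1998_map_mem_algebraicClasses)` are now
unconditional). [cite: Fulton1998, §19.2 Cor. 19.2 (b), Prop. 19.2, §5.1, §6.2 and Thm. 3.3 (b)]
[cite: VoisinHodgeII2003, Prop. 9.21 (i)] [cite: Hartshorne1977, II Thm. 8.24 (b)] -/
theorem fulton1998_map_mem_algebraicClasses_holds : fulton1998_map_mem_algebraicClasses :=
  fun _ _ _ _ j hY hX p β hβ ↦
    PullbackAlgebraic_of_exceptionalDivisor₂ stub_exceptionalDivisorLocallyTrivial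
      (stub_exceptionalDivisorSmoothProjective stub_exceptionalDivisorLocallyTrivial) sectionPullback
      hX hY j p β hβ

/-- **Pull-back along a `ℂ`-morphism of smooth projective varieties preserves algebraic classes**
(Fulton 1998, Cor. 19.2 (b); Voisin II Prop. 9.21 (i)) — the shared crux item stmt-HodgeConjecture-1071
as its primary decl `QbarEnvelope.PullbackAlgebraic`: for `ι : X ⟶ W` with `X`, `W` smooth projective and
`c' ∈ Nᵖ H²ᵖ(W(ℂ); ℂ)`, `ι^* c' ∈ Nᵖ H²ᵖ(X(ℂ); ℂ)`. Deformation to the normal cone in coniveau form,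
constant lift, Zariski-local triviality of the exceptional divisor, section pull-back by Leray–Hirsch.
[cite: Fulton1998, Cor. 19.2 (b), §5.1, §6.2 and Thm. 3.3 (b)] [cite: VoisinHodgeII2003, Prop. 9.21 (i)]
[cite: Hartshorne1977, II Thm. 8.24 (b)] -/
theorem pullbackAlgebraic_qbarEnvelope_proof :
    (Summit.HodgeConjecture.HodgeConjecture.Theses.QbarEnvelope.PullbackAlgebraic : Prop) :=
  fulton1998_map_mem_algebraicClasses_holds.pullbackAlgebraic

/-- **The crux `PullbackAlgebraic` of route `BoundaryReadout`** (syntactically the same decl as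
`QbarEnvelope.PullbackAlgebraic`; the shared item stmt-HodgeConjecture-1071): pull-back along any
`ℂ`-morphism `ι : X ⟶ W` of smooth projective complex varieties maps `algebraicClasses W p` into
`algebraicClasses X p`. [cite: Fulton1998, Cor. 19.2 (b)] [cite: VoisinHodgeII2003, Prop. 9.21 (i)] -/
theorem boundaryReadout_pullbackAlgebraic_proof :
    (Summit.HodgeConjecture.HodgeConjecture.Theses.BoundaryReadout.PullbackAlgebraic : Prop) :=
  fun _ _ hX _ _ hW ι p c' hc' ↦ pullbackAlgebraic_qbarEnvelope_proof hX hW ι p c' hc'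

end Summit.HodgeConjecture.HodgeConjecture.Theorems

end
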